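import Summits.HodgeConjecture.CorCM.B01.Transposition.Item6PlacementJunctionAppendixCGood
import Literature.NumberTheory.Automorphic.Liu2021.Prop413MultLeOneOfAsPrinted
import HarnessLib

/-!
# Δ2 BRIDGE — `HcmPieces` (the four sublemmas S1–S4 of the CM-side contract `hcm` as ONE record), the sorry-free ASSEMBLY
# `hcm_of_pieces`, and the RESOLVED INCREMENT «[Liu2021, Thm. 4.18] AS PRINTED ∧ named pins ⟹ `Thm418Combined`» in two forms

Cell pub-hodgecm2 (COR-CM), Δ2 BRIDGE, COORDINATOR «Δ2 RESTRUCTURE FOR SPEED» 2026-08-23; assembler seat planner-pub-hodgecm2-d2bridge-plan-g0-0.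
The structure `HcmPieces`, `hcm_of_pieces` and `thm418Combined_of_asPrinted_resolved` are VERBATIM the statement seat's desk skeleton
`HOME/d2bridge/HcmSkeleton.lean` (md5 166aa944b367, farm rc 0; literature-prover-pub-hodgecm2-d2bridge-stmt-g0-0) minus its pin placeholder,
with ONE amendment (v2, prove-4 = prover-pub-hodgecm2-d2bridge-prove-4-g0-0, HOME/INBOX l. 10782; ACCEPTED by the assembler, DECISION #2
l. 10783): the S1∕S4 fields are `ℚ`-INDEXED —
`dLiu : ℚ → CM`, `admLiu : ∀ q, adm (dLiu q)`, `qOf`, `f_of φ : Mor (dLiu (qOf φ))`, `geom_eq … = geom (dLiu (qOf φ)) (f_of φ)` — because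
`Hom_E(A_K, A_μ)_ℚ = ℚ ⊗_ℤ Hom` carries rational multiples of morphisms, the `hcm`-class is `ℚ`-linear in `φ`, while for a FIXED record `d` the
classes `f^* α_d` (`f : P_Γ ⟶ A_d`) lie in a finitely generated `ℤ`-module; the factor is absorbed by rescaling the eigenvector of Liu's record
(admissibility reads only the reflex data of a record); and (v3, same seat) the carrier field `CM` is universe-polymorphic (`CM : Type v`),
since the pin's `HodgeCM.Model.LiuCMSide` lives in `Type 1`; and (v4, same seat) §«Small levels»: `thm418Combined_of_subset_below`,
`HcmPieces.nonempty_mono`, `nonempty_hcmPieces_univ`, `thm418Combined_of_asPrinted_resolved_small` (+ the Schur step extracted as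
`rank_intertwiningMap_le_one_of_decomposition`, so that the small-levels lemma composes with it in one line) — the pieces are asked only at the levels
`K ≤ Ks μ` (at the pin `res K = resTotal K` is an arbitrary extension off the image of `H¹(X_K)`, so `hcm`∕`pieces` at ALL `K : Level V` is
not dischargeable there; Thm. 4.18 (1) needs them only for `K` sufficiently small).  This module is their TREE HOME, imported by the four
provers' pin-instance files;
nothing landed is edited or restated.  ADDED here:
`thm418Combined_of_asPrinted_resolved_of_decomposition` — the same resolved increment with the multiplicity pin `hmultD` (R5; only printed
supplier = PROOF sentence l. 2145) REPLACED by inputs in the currency of the STATEMENTS as printed: an equivariant decomposition of the tower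
`Φ413 ∕ hΦ413` into summands `σ413 t` ([Liu2021, Prop. 4.13]'s statement shape), Def. 4.11's adjectives of the summands `h411W`, their
pairwise non-isomorphy `hsepW` (Thm. 4.18 (2) ∕ Lem. D.1 (3) shape) and Def. 4.11 at the rest `hirrD` — the derivation is own-htheta g9's
(`…_of_good_of_decomposition`, HOME/INBOX l. 10749: Schur in Hom-space form, ✔ `AdmissibleDirectSum.rank_intertwiningMap_le_one_of_equivariant_directSum`).
HOLE-FREE: imports the ✔ junction `…Transposition.Item6PlacementJunctionAppendixCGood` (p354237) and the ✔ Literature file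
`Liu2021/Prop413MultLeOneOfAsPrinted` (p360220 ∕ p361285 ∕ p362232) — not the `HodgeCM.Model.Universe` cone; OUTSIDE the port manifest.

SURVIVING BINDERS of `thm418Combined_of_asPrinted_resolved_of_decomposition` (the Δ2 residual in typed form, generic over the ported codes
`V : HermSpace3 L ι₁`, `T : LiuAlbaneseModuleDatum ↥V.adelicFin Level.K`, abstract `res ∕ cmCl`):
* DATA built at the pin: `C` (§4.2 ∕ App. C standing data), `R μ hμ hg` (the rest of Thm. 4.18's datum per good character), `Good ∕ hbad`;
* CITES AS PRINTED (displayed): `hLiu : Thm418AsPrinted (toThm418Data C (R μ hμ hg))` [Thm. 4.18]; `σ413 ∕ Φ413 ∕ hΦ413` [Prop. 4.13, statement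
  shape at the tower]; `h411W`, `hirrD` [Def. 4.11 ⇐ App. D Lem. D.1 (1)]; `hsepW` [Thm. 4.18 (2) ⇐ Lem. D.1 (3)]; `hnvD` [Lem. D.1 (1)];
* X-PINS (identifications model ↔ Liu): `σ ∕ hσ ∕ e ∕ he` (X3-ω: the model's μ-pieces ARE Liu's `ω(μ,ε,χ)`), `M ∕ jH ∕ hjHinj ∕ hjH` (X1: the
  rational record of the proof's map (4.2)–(4.3) read injectively and equivariantly into the tower), `pieces` (X2 = S1–S4 per good μ and
  level: Liu's own CM datum is admissible, the record's pull-back is Betti pull-back, Lem. 2.4 (1) + tower bookkeeping, functoriality).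
Conclusion `T.Thm418Combined res cmCl` = the BODY of `HodgeCM.Model.LiuDictionary.Thm418C` (`Model/LiuDictionary.lean` :212, port-gated today).
HC_CM is NOT proved; «Δ2 BRIDGE CLOSED» is NOT claimed; `hLiu` of the COR-CM END stays the READING r8 until the pin instances land and the
referee signs; no pointer ∕ count ∕ hM token.

## References
* [Liu2021] Y. Liu, *Fourier–Jacobi cycles and arithmetic relative trace formula*, Camb. J. Math. 9 (2021) = arXiv:2102.11518 — Thm. 4.18
  (FJcycle.tex l. 2232–2245) and its proof (l. 2247–2268), Prop. 4.13 (l. 2113–2119), Def. 4.11 (l. 2083–2095), Def. 4.5 (2) (l. 1944–1960),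
  Rem. 4.17, Lem. 2.4 (1) (l. 1210–1213), App. D Lem. D.1 (l. 5226–5235).
* [Bump1997] D. Bump, *Automorphic forms and representations*, CUP 1997 — Prop. 4.2.4 (Schur's lemma for irreducible admissibles).
-/

set_option autoImplicit false

noncomputable section

open scoped DirectSum TensorProduct

namespace HodgeCM.Literature.Theta.LiuAlbaneseModuleDatum.D2Bridge

open HodgeCM.Literature.Theta HodgeCM.Literature.Theta.LiuAlbaneseModuleDatum
open Summit.HodgeConjecture.CorCM
open Literature.AlgebraicGeometry.ShimuraVarieties.UnitaryCanonicalModel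
open Literature.NumberTheory.Automorphic.Liu2021 Literature.NumberTheory.Automorphic.Liu2021.AppendixC NumberField
open Literature.RepresentationTheory
open MulAction

universe u v w

/-- **The four sublemmas S1–S4 of `hcm`, as DATA + LAWS over abstract model-side carriers**, for ONE datum `D` (= `toThm418Data C (R μ hμ hg)`),
ONE rational record `M` of the proof's map (4.2), ONE reading `jH : M.HB → H` into the tower, ONE level (`KK = K.K`, target space `W` = `H¹(P_Γ;ℂ)`,
restriction `res : H → W`) and ONE generator set `cmCl ⊆ W`.
Carriers the PIN supplies: `AK` = `H¹_B(A_K ⊗_{E,ι₁} ℂ; ℂ)`, `XK` = `H¹_B(X_K ⊗_{E,ι₁} ℂ; ℂ)` (or of `X_K(ℂ)`), `CM` = the model's CM records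
(`LiuCMSide`), `Mor d` = `ℂ`-morphisms `P_Γ ⟶ d.A.X`, `geom d f` = `geomClass Γ d f`. -/
structure HcmPieces
    {F E : Type} [Field F] [NumberField F] [IsTotallyReal F] [Field E] [NumberField E] [Algebra F E]
    [IsTotallyComplex E] [Algebra.IsQuadraticExtension F E]
    (D : Thm418Data F E) (M : D.Map43RationalData)
    (H : Type u) [AddCommGroup H] [Module ℂ H] (jH : M.HB →ₗ[ℂ] H)
    (KK : Subgroup D.G) (W : Type w) [AddCommGroup W] [Module ℂ W] (res : H →ₗ[ℂ] W) (cmCl : Set W) :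
    Type (max u v w + 1) where
  -- ── S2 · «Thm 4.18 (1) ∕ Rem 4.17 bookkeeping: the record's pull-back IS Betti pull-back along the real morphism φ» (prove-2) ──
  /-- ⟨pin⟩ `H¹_B(A_K ⊗_{E,ι₁} ℂ; ℂ)` at the level `K`. -/
  AK : Type
  [instAK₁ : AddCommGroup AK]
  [instAK₂ : Module ℂ AK]
  /-- ⟨pin⟩ Betti pull-back along (a ℚ-multiple of) the REAL morphism `φ : A_K → A_μ`, `ℚ`-linearly extended to `Hom_E(A_K,A_μ)_ℚ = ℚ ⊗ Hom`,
  on complexified classes of `A_μ`: `φ ↦ (c ↦ φ^*_ℂ c)`. -/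
  phiStar : D.HomK KK M.Dμ → (ℂ ⊗[ℚ] M.L) →ₗ[ℂ] AK
  /-- ⟨pin⟩ pull-back along the projection `A_∞ → A_K` into `H¹_B(A_∞ ⊗ ℂ; ℂ) = M.HB` (the colimit's structure map at level `K`). -/
  transK : AK →ₗ[ℂ] M.HB
  /-- **S2.** The proof's map (4.2) at a level-`K` generator: `ι ((P (res_D φ)) ⊗ α) = transK (φ^*_ℂ α)` — at the pin a CONSTRUCTION LAW of the
  record `M` (its `P` is built as `f ↦ f^*` on `Ω(μ) = colim_K Hom_E(A_K, A_μ)_ℚ`, Rem 4.17 ∕ Thm 4.18 (1) READING G2 `res_pull`). -/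
  P_eq : ∀ φ : D.HomK KK M.Dμ, M.ι (((M.P (D.res KK M.Dμ φ))).baseChange ℂ M.α) = transK (phiStar φ M.α)
  -- ── S3 · «Lem 2.4 (1): H¹_B(Alb_X, ℚ) ≃ H¹_B(X, ℚ)» + tower bookkeeping (prove-3) ──
  /-- ⟨pin⟩ `H¹_B(X_K ⊗_{E,ι₁} ℂ; ℂ)`. -/
  XK : Type
  [instXK₁ : AddCommGroup XK]
  [instXK₂ : Module ℂ XK]
  /-- **S3 (data).** Lem 2.4 (1) complexified at `X = X_K`: `(α_K)^*_ℂ : H¹_B(A_K;ℂ) ≃ H¹_B(X_K;ℂ)` — at the pin BY NAME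
  `Model.isIso_bettiCohomology_map_abelJacobi_pms` (`CorCM/Geometry/AlbaneseRangeBallQuotient.lean` :69). -/
  albK : AK ≃ₗ[ℂ] XK
  /-- ⟨pin⟩ restriction `H¹_B(X_K;ℂ) → H¹(P_Γ;ℂ) = W` to the identity connected component. -/
  resX : XK →ₗ[ℂ] W
  /-- **S3 (law).** Tower bookkeeping «`H = colim_K H¹_{τ'}(X_K, ℂ)` — the form in which the model BUILDS it» (leaf docstring :73–:75): a level-`K`
  class of `A` read into the tower through `jH ∘ transK` and restricted by `res` equals its image under `α_K^*` restricted to `P_Γ`. -/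
  tower_eq : ∀ c : AK, res (jH (transK c)) = resX (albK c)
  -- ── S1 · «Def 4.5 (2) ⇒ Liu's own CM datum is admissible» (prove-1) ──
  /-- ⟨pin⟩ the model's CM records (`LiuCMSide : Type 1` — hence the universe parameter `v`; v3). -/
  CM : Type v
  /-- ⟨pin⟩ admissibility at `μ` (`T.adm μ d = d.IsReflexOfTypeG ι₁ (line …).lineType`). -/
  adm : CM → Prop
  /-- ⟨pin⟩ `ℂ`-morphisms `P_Γ ⟶ d.A.X`. -/
  Mor : CM → Type
  /-- ⟨pin⟩ `geomClass Γ d f = (pull f 1).baseChange ℂ d.α`. -/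
  geom : (d : CM) → Mor d → W
  /-- ⟨pin⟩ `cmCl = ⋃ d, ⋃ (_ : adm d), range (geom d)` ⊇ — at the pin `LiuDictionary.geomClass_mem_cmClasses` (by definition of `cmClasses`). -/
  geom_mem : ∀ d, adm d → ∀ f : Mor d, geom d f ∈ cmCl
  /-- **S1 (data).** Liu's OWN CM datum for `μ` read as a model record, as a `ℚ`-FAMILY in the eigenvector:
  `d_Liu q = (A_μ ⊗_{E,ι₁} ℂ, q • α, M_μ ⊆ ℂ, Φ_{A_μ,ι₁}, …)` for the object `D_μ = M.Dμ ∈ 𝒜(μ)` (Def 4.5 (2)) and the eigenvector `α = M.α`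
  (proof of 4.18, l.2250); `q = 1` is the printed datum.  (v2: the family is needed because `Hom_E(A_K, A_μ)_ℚ = ℚ ⊗ Hom` carries RATIONAL
  multiples of morphisms while `geom d f = f^* α_d` does not — the factor is absorbed into `α_{d_q} = q • α`; admissibility reads only the
  reflex data `(K', Φ', k, τ)` of a record, not `(A, α)`.) -/
  dLiu : ℚ → CM
  /-- **S1 (law).** `adm μ (d_Liu q)` for every `q`: by Def 4.5 (2) (determinant condition + CM character `μ^alg`) the CM type of `A_μ` at `ι₁` is
  the INFLATED REFLEX type of `(E, Φ_μ)` — at the pin BY NAME `LiuCMData.cmType_eq_inflate_of_det45` ∕ `Model.hCMisogE_of_det45` (X2a ✔) + the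
  record identification; ONE proof for all `q` (the predicate ignores `α`). -/
  admLiu : ∀ q : ℚ, adm (dLiu q)
  -- ── S4 · functoriality ∕ assembly of the composite morphism (prove-4) ──
  /-- **S4 (data).** The rational factor of `φ`: writing `φ = q_φ ⊗ f_φ` with ONE morphism `f_φ ∈ Hom_E(A_K, A_μ)` (every element of
  `ℚ ⊗_ℤ Hom` has this form), `qOf φ := q_φ`. -/
  qOf : D.HomK KK M.Dμ → ℚ
  /-- **S4 (data).** `φ ↦ f_φ,ℂ ∘ (α_K)_x ∘ (P_Γ ↪ X_{K,ℂ}) : P_Γ ⟶ A_μ ⊗_{E,ι₁} ℂ = (d_Liu q_φ).A.X` (any base point `x`; Def 2.3, (4.1)). -/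
  f_of : ∀ φ : D.HomK KK M.Dμ, Mor (dLiu (qOf φ))
  /-- **S4 (law).** Functoriality of Betti `H¹` along the composite (`BettiUniverse.pull_comp`), additivity of `f ↦ f^*` on `H¹` of abelian
  varieties, base-point irrelevance on `H¹` (Lem 2.4 proof l.1228), and `α_{d_Liu q} = q • α`:
  `resX ((α_K)^* (φ^* α)) = q_φ • (f_φ,ℂ ∘ (α_K)_x ∘ incl)^* α = geom (d_Liu q_φ) (f_of φ)`. -/
  geom_eq : ∀ φ : D.HomK KK M.Dμ, resX (albK (phiStar φ M.α)) = geom (dLiu (qOf φ)) (f_of φ)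

attribute [instance] HcmPieces.instAK₁ HcmPieces.instAK₂ HcmPieces.instXK₁ HcmPieces.instXK₂

/-- **ASSEMBLY (sorry-free): S1 ∧ S2 ∧ S3 ∧ S4 ⟹ the `hcm` binder** at one `(D, M, jH, K, res, cmCl)`. [cite: Liu2021, Thm. 4.18 (1), Rem. 4.17, Lem. 2.4 (1), Def. 4.5 (2), proof of Thm. 4.18 l. 2247–2253] -/
theorem hcm_of_pieces
    {F E : Type} [Field F] [NumberField F] [IsTotallyReal F] [Field E] [NumberField E] [Algebra F E]
    [IsTotallyComplex E] [Algebra.IsQuadraticExtension F E]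
    {D : Thm418Data F E} {M : D.Map43RationalData}
    {H : Type u} [AddCommGroup H] [Module ℂ H] {jH : M.HB →ₗ[ℂ] H}
    {KK : Subgroup D.G} {W : Type w} [AddCommGroup W] [Module ℂ W] {res : H →ₗ[ℂ] W} {cmCl : Set W}
    (S : HcmPieces D M H jH KK W res cmCl) (φ : D.HomK KK M.Dμ) :
    res (jH (M.ι (((M.P (D.res KK M.Dμ φ))).baseChange ℂ M.α))) ∈ cmCl := by
  rw [S.P_eq, S.tower_eq, S.geom_eq]
  exact S.geom_mem (S.dLiu (S.qOf φ)) (S.admLiu (S.qOf φ)) (S.f_of φ)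

/-- **THE RESOLVED INCREMENT (generic over the ported codes, hole-free): S₀ with R3 `hcm` REPLACED by the pieces S1–S4** (R4 `hnvD` ∕ R5 `hmultD`
kept in S₀'s shape here; own-htheta g9's `…_of_good_of_decomposition` l.10749 derives R5 from a Prop-4.13-shaped decomposition — plug it in at
assembly).  Conclusion `T.Thm418Combined res cmCl` (= `Thm418C` at `T.toLiuAlbaneseModuleDatum, T.res, T.cmClasses`).
[cite: Liu2021, Thm. 4.18 (l. 2232–2245) with proof l. 2247–2268, Thm. 4.18 (1), Lem. 2.4 (1), Def. 4.5 (2), Prop. 4.13 proof l. 2145, App. D Lem. D.1 (1)] -/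
theorem thm418Combined_of_asPrinted_resolved
    {L : HodgeCM.CMField} {ι₁ : L →+* ℂ} (V : HodgeCM.HermSpace3 L ι₁)
    (h : exists_recordSystem) (Φ : Literature.AlgebraicGeometry.Motives.CMType L)
    {isotropicAt : ℕ → Prop}
    (C : Sec42Data (Model.honestP5Of h ⟨L.K⟩ ι₁ ⟨V.Hm, V.isHermitian, V.signature_ι₁, V.posDef_of_ne⟩ Φ) isotropicAt)
    (T : LiuAlbaneseModuleDatum ↥V.adelicFin (HodgeCM.Level.K : HodgeCM.Level V → Subgroup ↥V.adelicFin))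
    {W : HodgeCM.Level V → Type w} [∀ K, AddCommGroup (W K)] [∀ K, Module ℂ (W K)]
    (res : ∀ K : HodgeCM.Level V, T.H →ₗ[ℂ] W K) (cmCl : ∀ K : HodgeCM.Level V, T.Char → Set (W K))
    (Good : T.Char → Prop) (hbad : ∀ μ : T.Char, T.PhiMu μ → ¬ Good μ → T.block μ = ⊥)
    (R : ∀ μ : T.Char, T.PhiMu μ → Good μ → Thm418Rest C)
    (hLiu : ∀ (μ : T.Char) (hμ : T.PhiMu μ) (hg : Good μ), Thm418AsPrinted (toThm418Data C (R μ hμ hg)))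
    (σ : ∀ (μ : T.Char) (hμ : T.PhiMu μ) (hg : Good μ), T.Adm μ → (toThm418Data C (R μ hμ hg)).AdmIndex)
    (hσ : ∀ (μ : T.Char) (hμ : T.PhiMu μ) (hg : Good μ), Function.Injective (σ μ hμ hg))
    (e : ∀ (μ : T.Char) (hμ : T.PhiMu μ) (hg : Good μ) (a : T.Adm μ),
      T.Ω μ a ≃ₗ[ℂ] (toThm418Data C (R μ hμ hg)).omegaAt (σ μ hμ hg a))
    (he : ∀ (μ : T.Char) (hμ : T.PhiMu μ) (hg : Good μ) (a : T.Adm μ) (g : ↥V.adelicFin) (m : T.Ω μ a),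
      e μ hμ hg a (MonoidAlgebra.of ℂ ↥V.adelicFin g • m) = (toThm418Data C (R μ hμ hg)).rhoAt (σ μ hμ hg a) g (e μ hμ hg a m))
    (M : ∀ (μ : T.Char) (hμ : T.PhiMu μ) (hg : Good μ), (toThm418Data C (R μ hμ hg)).Map43RationalData)
    (jH : ∀ (μ : T.Char) (hμ : T.PhiMu μ) (hg : Good μ), (M μ hμ hg).HB →ₗ[ℂ] T.H)
    (hjHinj : ∀ (μ : T.Char) (hμ : T.PhiMu μ) (hg : Good μ), Function.Injective (jH μ hμ hg))
    (hjH : ∀ (μ : T.Char) (hμ : T.PhiMu μ) (hg : Good μ) (g : ↥V.adelicFin) (x : (M μ hμ hg).HB),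
      jH μ hμ hg ((M μ hμ hg).ρB g x) = MonoidAlgebra.of ℂ ↥V.adelicFin g • jH μ hμ hg x)
    -- ── R3 RESOLVED: the four pieces per (good μ, level K) instead of `hcm` ──
    (pieces : ∀ (μ : T.Char) (hμ : T.PhiMu μ) (hg : Good μ) (K : HodgeCM.Level V),
      HcmPieces (toThm418Data C (R μ hμ hg)) (M μ hμ hg) T.H (jH μ hμ hg) K.K (W K) (res K) (cmCl K μ))
    (hnvD : ∀ (μ : T.Char) (hμ : T.PhiMu μ) (hg : Good μ) (i : (toThm418Data C (R μ hμ hg)).AdmIndex),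
      Nontrivial ((toThm418Data C (R μ hμ hg)).omegaAt i))
    (hmultD : ∀ (μ : T.Char) (hμ : T.PhiMu μ) (hg : Good μ) (i : (toThm418Data C (R μ hμ hg)).AdmIndex),
      Module.rank ℂ (Representation.IntertwiningMap ((toThm418Data C (R μ hμ hg)).rhoAt i)
        (Representation.ofModule' (k := ℂ) (G := ↥V.adelicFin) T.H)) ≤ 1) :
    T.Thm418Combined res cmCl :=
  thm418Combined_of_thm418AsPrintedC_summands_records_of_good V h Φ C T res cmCl Good hbad R hLiu σ hσ e he M jH hjHinj hjH
    (fun μ hμ hg K φ => hcm_of_pieces (pieces μ hμ hg K) φ) hnvD hmultD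

/-- **The multiplicity pin from a Prop-4.13-shaped decomposition** (own-htheta g9's derivation, HOME/INBOX l. 10749, extracted so that
every resolved lemma — all levels or small levels — can consume it): an irreducible-or-zero NON-ZERO representation `ρ` of
`U(V)(𝔸_{L₀,f})` has `dim Hom_G(ρ, H) ≤ 1` as soon as `H` decomposes equivariantly (`Φ413 ∕ hΦ413`) into summands that are
irreducible-or-zero ∕ smooth ∕ admissible (`h411W`) and pairwise non-isomorphic (`hsepW`) — Schur in Hom-space form
(✔ `AdmissibleDirectSum.rank_intertwiningMap_le_one_of_equivariant_directSum`; the compact open it needs is any level of `V`).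
[cite: Liu2021, Prop. 4.13 (l. 2113–2119), Def. 4.11, Thm. 4.18 (2)] [cite: Bump1997, Proposition 4.2.4] -/
theorem rank_intertwiningMap_le_one_of_decomposition
    {L : HodgeCM.CMField} {ι₁ : L →+* ℂ} (V : HodgeCM.HermSpace3 L ι₁)
    {Hc : Type u} [AddCommGroup Hc] [Module ℂ Hc] [Module (MonoidAlgebra ℂ ↥V.adelicFin) Hc]
    [IsScalarTower ℂ (MonoidAlgebra ℂ ↥V.adelicFin) Hc]
    {Vρ : Type} [AddCommGroup Vρ] [Module ℂ Vρ] (ρ : Representation ℂ ↥V.adelicFin Vρ) [Nontrivial Vρ]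
    (hirr : IsIrreducibleOrZero ρ)
    {ι413 : Type} {W413 : ι413 → Type} [∀ t, AddCommGroup (W413 t)] [∀ t, Module ℂ (W413 t)]
    (σ413 : ∀ t : ι413, Representation ℂ ↥V.adelicFin (W413 t))
    (Φ413 : Hc ≃ₗ[ℂ] ⨁ t, W413 t)
    (hΦ413 : ∀ (g : ↥V.adelicFin) (x : Hc) (t : ι413),
      Φ413 (Representation.ofModule' (k := ℂ) (G := ↥V.adelicFin) Hc g x) t = σ413 t g (Φ413 x t))
    (h411W : ∀ t : ι413, IsIrreducibleOrZero (σ413 t) ∧ IsSmoothRep (σ413 t) ∧ IsAdmissibleRep (σ413 t))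
    (hsepW : ∀ s t : ι413, Nontrivial (W413 s) →
      (∃ f : W413 s ≃ₗ[ℂ] W413 t, ∀ (g : ↥V.adelicFin) (v : W413 s), f (σ413 s g v) = σ413 t g (f v)) → s = t) :
    Module.rank ℂ (Representation.IntertwiningMap ρ (Representation.ofModule' (k := ℂ) (G := ↥V.adelicFin) Hc)) ≤ 1 := by
  obtain ⟨Γ₀⟩ := (inferInstance : Nonempty (HodgeCM.Level V))
  haveI : ρ.IsIrreducible := isIrreducible_of_isIrreducibleOrZero hirr inferInstance
  exact AdmissibleDirectSum.rank_intertwiningMap_le_one_of_equivariant_directSum (ρ := ρ) (σ := σ413) Φ413 hΦ413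
    (fun t ht => isIrreducible_of_isIrreducibleOrZero (h411W t).1 ht)
    (fun t => isAdmissible_of_isSmoothRep_of_isAdmissibleRep (h411W t).2.1 (h411W t).2.2)
    (fun s t hs ⟨f⟩ => hsepW s t hs ⟨f.toLinearEquiv, fun g v => by
      rw [Representation.Equiv.toLinearEquiv_apply, Representation.Equiv.toLinearEquiv_apply]
      exact f.toIntertwiningMap.isIntertwining _ _ g v⟩)
    ⟨Γ₀.K, Γ₀.isOpen_K, Γ₀.isCompact_K⟩

/-- **THE RESOLVED INCREMENT WITH THE MULTIPLICITY PIN DERIVED FROM [Liu2021, Prop. 4.13]'s STATEMENT SHAPE** (own-htheta g9's derivation,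
HOME/INBOX l. 10749, composed with `thm418Combined_of_asPrinted_resolved`): as `thm418Combined_of_asPrinted_resolved`, binder for binder,
except that `hmultD` is no longer asked — it is DERIVED from an equivariant decomposition `Φ413 ∕ hΦ413` of the tower into summands `σ413 t`
that are irreducible-or-zero ∕ smooth ∕ admissible (`h411W`) and pairwise non-isomorphic (`hsepW`), the rest's summands being
irreducible-or-zero (`hirrD`) and non-zero (`hnvD`); the compact open subgroup Schur needs is any level.
[cite: Liu2021, Thm. 4.18 (l. 2232–2245) with proof l. 2247–2268, Prop. 4.13 (l. 2113–2119), Def. 4.11, Thm. 4.18 (1), (2), Lem. 2.4 (1), Def. 4.5 (2), App. D Lem. D.1 (1), (3)]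
[cite: Bump1997, Proposition 4.2.4] -/
theorem thm418Combined_of_asPrinted_resolved_of_decomposition
    {L : HodgeCM.CMField} {ι₁ : L →+* ℂ} (V : HodgeCM.HermSpace3 L ι₁)
    (h : exists_recordSystem) (Φ : Literature.AlgebraicGeometry.Motives.CMType L)
    {isotropicAt : ℕ → Prop}
    (C : Sec42Data (Model.honestP5Of h ⟨L.K⟩ ι₁ ⟨V.Hm, V.isHermitian, V.signature_ι₁, V.posDef_of_ne⟩ Φ) isotropicAt)
    (T : LiuAlbaneseModuleDatum ↥V.adelicFin (HodgeCM.Level.K : HodgeCM.Level V → Subgroup ↥V.adelicFin))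
    {W : HodgeCM.Level V → Type w} [∀ K, AddCommGroup (W K)] [∀ K, Module ℂ (W K)]
    (res : ∀ K : HodgeCM.Level V, T.H →ₗ[ℂ] W K) (cmCl : ∀ K : HodgeCM.Level V, T.Char → Set (W K))
    (Good : T.Char → Prop) (hbad : ∀ μ : T.Char, T.PhiMu μ → ¬ Good μ → T.block μ = ⊥)
    (R : ∀ μ : T.Char, T.PhiMu μ → Good μ → Thm418Rest C)
    -- ── THE CITE: [Liu21] Thm 4.18 EXACTLY AS PRINTED ──
    (hLiu : ∀ (μ : T.Char) (hμ : T.PhiMu μ) (hg : Good μ), Thm418AsPrinted (toThm418Data C (R μ hμ hg)))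
    -- ── X3-ω ──
    (σ : ∀ (μ : T.Char) (hμ : T.PhiMu μ) (hg : Good μ), T.Adm μ → (toThm418Data C (R μ hμ hg)).AdmIndex)
    (hσ : ∀ (μ : T.Char) (hμ : T.PhiMu μ) (hg : Good μ), Function.Injective (σ μ hμ hg))
    (e : ∀ (μ : T.Char) (hμ : T.PhiMu μ) (hg : Good μ) (a : T.Adm μ),
      T.Ω μ a ≃ₗ[ℂ] (toThm418Data C (R μ hμ hg)).omegaAt (σ μ hμ hg a))
    (he : ∀ (μ : T.Char) (hμ : T.PhiMu μ) (hg : Good μ) (a : T.Adm μ) (g : ↥V.adelicFin) (m : T.Ω μ a),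
      e μ hμ hg a (MonoidAlgebra.of ℂ ↥V.adelicFin g • m) = (toThm418Data C (R μ hμ hg)).rhoAt (σ μ hμ hg a) g (e μ hμ hg a m))
    -- ── X1 ──
    (M : ∀ (μ : T.Char) (hμ : T.PhiMu μ) (hg : Good μ), (toThm418Data C (R μ hμ hg)).Map43RationalData)
    (jH : ∀ (μ : T.Char) (hμ : T.PhiMu μ) (hg : Good μ), (M μ hμ hg).HB →ₗ[ℂ] T.H)
    (hjHinj : ∀ (μ : T.Char) (hμ : T.PhiMu μ) (hg : Good μ), Function.Injective (jH μ hμ hg))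
    (hjH : ∀ (μ : T.Char) (hμ : T.PhiMu μ) (hg : Good μ) (g : ↥V.adelicFin) (x : (M μ hμ hg).HB),
      jH μ hμ hg ((M μ hμ hg).ρB g x) = MonoidAlgebra.of ℂ ↥V.adelicFin g • jH μ hμ hg x)
    -- ── X2 RESOLVED: the four pieces S1–S4 per (good μ, level K) ──
    (pieces : ∀ (μ : T.Char) (hμ : T.PhiMu μ) (hg : Good μ) (K : HodgeCM.Level V),
      HcmPieces (toThm418Data C (R μ hμ hg)) (M μ hμ hg) T.H (jH μ hμ hg) K.K (W K) (res K) (cmCl K μ))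
    -- ── [Lem D.1 (1)] non-vanishing and [Def 4.11] irreducibility of the rest's summands ──
    (hnvD : ∀ (μ : T.Char) (hμ : T.PhiMu μ) (hg : Good μ) (i : (toThm418Data C (R μ hμ hg)).AdmIndex),
      Nontrivial ((toThm418Data C (R μ hμ hg)).omegaAt i))
    (hirrD : ∀ (μ : T.Char) (hμ : T.PhiMu μ) (hg : Good μ) (i : (toThm418Data C (R μ hμ hg)).AdmIndex),
      IsIrreducibleOrZero ((toThm418Data C (R μ hμ hg)).rhoAt i))
    -- ── [Prop 4.13]'s STATEMENT shape at the tower: an equivariant decomposition into summands `σ413 t` ──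
    {ι413 : Type} {W413 : ι413 → Type} [∀ t, AddCommGroup (W413 t)] [∀ t, Module ℂ (W413 t)]
    (σ413 : ∀ t : ι413, Representation ℂ ↥V.adelicFin (W413 t))
    (Φ413 : T.H ≃ₗ[ℂ] ⨁ t, W413 t)
    (hΦ413 : ∀ (g : ↥V.adelicFin) (x : T.H) (t : ι413),
      Φ413 (Representation.ofModule' (k := ℂ) (G := ↥V.adelicFin) T.H g x) t = σ413 t g (Φ413 x t))
    -- ── [Def 4.11]'s adjectives of the summands, and their pairwise non-isomorphy [Thm 4.18 (2) ∕ Lem D.1 (3)] ──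
    (h411W : ∀ t : ι413, IsIrreducibleOrZero (σ413 t) ∧ IsSmoothRep (σ413 t) ∧ IsAdmissibleRep (σ413 t))
    (hsepW : ∀ s t : ι413, Nontrivial (W413 s) →
      (∃ f : W413 s ≃ₗ[ℂ] W413 t, ∀ (g : ↥V.adelicFin) (v : W413 s), f (σ413 s g v) = σ413 t g (f v)) → s = t) :
    T.Thm418Combined res cmCl :=
  -- the multiplicity pin, DERIVED (own-htheta g9): the source summand is read as a representation of `↥V.adelicFin`
  -- (= `(toThm418Data C (R μ hμ hg)).G` definitionally)
  thm418Combined_of_asPrinted_resolved V h Φ C T res cmCl Good hbad R hLiu σ hσ e he M jH hjHinj hjH pieces hnvD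
    fun μ hμ hg i =>
      haveI := hnvD μ hμ hg i
      rank_intertwiningMap_le_one_of_decomposition V (Hc := T.H) ((toThm418Data C (R μ hμ hg)).rhoAt i)
        (hirrD μ hμ hg i) σ413 Φ413 hΦ413 h411W hsepW

/-! ## Small levels only (v4): `pieces` — like the `hcm` binder it replaces — is USED only below the threshold of Thm. 4.18 (1);
at the pin `res K = TowerCarrier.resTotal K` is an ARBITRARY linear extension off the image of `H¹(X_K)` (`Model/TowerRes.lean` :92 `toLevel` =
a chosen left inverse, :136 `resTotal` = `0` off the tower's index set), so the pieces can only be built for `K.K ≤ K₀` (App. C's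
«sufficiently small», `Sec42Data.levelOf`).  The variants below ask them only there and feed the all-levels lemma with TRIVIAL pieces at
the other levels (generator set `Set.univ`), then shrink `K₀`. -/

section SmallLevels

universe u₁ u₂

/-- **`Thm418Combined` only reads the generator sets below its own threshold**: if `cmCl' K μ ⊆ cmCl K μ` for all `K ≤ Ks μ`, then the
combined reading for `cmCl'` gives it for `cmCl` (shrink `K₀` to `K₀ ⊓ Ks μ`; «⊆ span» is monotone). [cite: Liu2021, Thm. 4.18 (1) («for every sufficiently small open compact subgroup»)] -/
theorem thm418Combined_of_subset_below {G : Type u₁} [Group G] {Lvl : Type u₂} [SemilatticeInf Lvl] {Kof : Lvl → Subgroup G}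
    {T : LiuAlbaneseModuleDatum G Kof} {W : Lvl → Type w} [∀ K, AddCommGroup (W K)] [∀ K, Module ℂ (W K)]
    {res : ∀ K : Lvl, T.H →ₗ[ℂ] W K} {cmCl cmCl' : ∀ K : Lvl, T.Char → Set (W K)} (Ks : T.Char → Lvl)
    (hsub : ∀ (μ : T.Char) (K : Lvl), K ≤ Ks μ → cmCl' K μ ⊆ cmCl K μ) (h : T.Thm418Combined res cmCl') :
    T.Thm418Combined res cmCl := by
  intro μ hμ
  obtain ⟨K₀, hK₀⟩ := h μ hμ
  refine ⟨K₀ ⊓ Ks μ, fun K hK x hx hfix => ?_⟩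
  exact Submodule.span_mono (hsub μ K (hK.trans inf_le_right)) (hK₀ K (hK.trans inf_le_left) x hx hfix)

variable {F E : Type} [Field F] [NumberField F] [IsTotallyReal F] [Field E] [NumberField E] [Algebra F E]
  [IsTotallyComplex E] [Algebra.IsQuadraticExtension F E]
  {D : Thm418Data F E} {M : D.Map43RationalData}
  {H : Type u} [AddCommGroup H] [Module ℂ H] {jH : M.HB →ₗ[ℂ] H}
  {KK : Subgroup D.G} {W : Type w} [AddCommGroup W] [Module ℂ W] {res : H →ₗ[ℂ] W}

/-- **`HcmPieces` is monotone in the generator set** (only `geom_mem` reads `cmCl`). [folklore] -/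
theorem HcmPieces.nonempty_mono {cmCl₁ cmCl₂ : Set W} (hle : cmCl₁ ⊆ cmCl₂) (S : HcmPieces.{u, v, w} D M H jH KK W res cmCl₁) :
    Nonempty (HcmPieces.{u, v, w} D M H jH KK W res cmCl₂) :=
  ⟨{ AK := S.AK, phiStar := S.phiStar, transK := S.transK, P_eq := S.P_eq, XK := S.XK, albK := S.albK, resX := S.resX,
     tower_eq := S.tower_eq, CM := S.CM, adm := S.adm, Mor := S.Mor, geom := S.geom,
     geom_mem := fun d hd f => hle (S.geom_mem d hd f), dLiu := S.dLiu, admLiu := S.admLiu, qOf := S.qOf, f_of := S.f_of,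
     geom_eq := S.geom_eq }⟩

variable (D M H jH KK W res) in
/-- **With generator set `Set.univ` the pieces are TRIVIALLY inhabited** (no input: `AK := M.HB`, `phiStar φ := ι ∘ (P (res_D φ)) ⊗ ℂ`,
`resX := res ∘ jH`, `geom _ φ :=` the class itself) — all the X2 content of `pieces` is in WHICH `cmCl` it serves; used at the levels
where nothing is claimed. [folklore] -/
theorem nonempty_hcmPieces_univ : Nonempty (HcmPieces.{u, v, w} D M H jH KK W res Set.univ) :=
  ⟨{ AK := M.HB
     phiStar := fun φ => M.ι ∘ₗ (M.P (D.res KK M.Dμ φ)).baseChange ℂ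
     transK := LinearMap.id
     P_eq := fun _ => rfl
     XK := M.HB
     albK := LinearEquiv.refl ℂ M.HB
     resX := res ∘ₗ jH
     tower_eq := fun _ => rfl
     CM := PUnit
     adm := fun _ => True
     Mor := fun _ => D.HomK KK M.Dμ
     geom := fun _ φ => res (jH (M.ι ((M.P (D.res KK M.Dμ φ)).baseChange ℂ M.α)))
     geom_mem := fun _ _ _ => Set.mem_univ _
     dLiu := fun _ => PUnit.unit
     admLiu := fun _ => trivial
     qOf := fun _ => 0
     f_of := fun φ => φ
     geom_eq := fun _ => rfl }⟩

/-- **THE RESOLVED INCREMENT WITH PIECES ONLY AT SMALL LEVELS**: as `thm418Combined_of_asPrinted_resolved`, but `pieces` is asked only for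
the levels `K ≤ Ks μ` (any threshold family `Ks`; at the pin: the level of App. C's `K₀`, below which `res K` IS the restriction to `P_K` of
classes coming from level `K`).  KERNEL: the all-levels lemma at the generator sets `{x | K ≤ Ks μ → x ∈ cmCl K μ}` (= `cmCl K μ` below the
threshold, `univ` above, where `nonempty_hcmPieces_univ` supplies the pieces), then `thm418Combined_of_subset_below`.
[cite: Liu2021, Thm. 4.18 (l. 2232–2245) with proof l. 2247–2268, Thm. 4.18 (1), Lem. 2.4 (1), Def. 4.5 (2), Prop. 4.13 proof l. 2145, App. D Lem. D.1 (1)] -/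
theorem thm418Combined_of_asPrinted_resolved_small
    {L : HodgeCM.CMField} {ι₁ : L →+* ℂ} (V : HodgeCM.HermSpace3 L ι₁)
    (h : exists_recordSystem) (Φ : Literature.AlgebraicGeometry.Motives.CMType L)
    {isotropicAt : ℕ → Prop}
    (C : Sec42Data (Model.honestP5Of h ⟨L.K⟩ ι₁ ⟨V.Hm, V.isHermitian, V.signature_ι₁, V.posDef_of_ne⟩ Φ) isotropicAt)
    (T : LiuAlbaneseModuleDatum ↥V.adelicFin (HodgeCM.Level.K : HodgeCM.Level V → Subgroup ↥V.adelicFin))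
    {W : HodgeCM.Level V → Type w} [∀ K, AddCommGroup (W K)] [∀ K, Module ℂ (W K)]
    (res : ∀ K : HodgeCM.Level V, T.H →ₗ[ℂ] W K) (cmCl : ∀ K : HodgeCM.Level V, T.Char → Set (W K))
    (Good : T.Char → Prop) (hbad : ∀ μ : T.Char, T.PhiMu μ → ¬ Good μ → T.block μ = ⊥)
    (R : ∀ μ : T.Char, T.PhiMu μ → Good μ → Thm418Rest C)
    (hLiu : ∀ (μ : T.Char) (hμ : T.PhiMu μ) (hg : Good μ), Thm418AsPrinted (toThm418Data C (R μ hμ hg)))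
    (σ : ∀ (μ : T.Char) (hμ : T.PhiMu μ) (hg : Good μ), T.Adm μ → (toThm418Data C (R μ hμ hg)).AdmIndex)
    (hσ : ∀ (μ : T.Char) (hμ : T.PhiMu μ) (hg : Good μ), Function.Injective (σ μ hμ hg))
    (e : ∀ (μ : T.Char) (hμ : T.PhiMu μ) (hg : Good μ) (a : T.Adm μ),
      T.Ω μ a ≃ₗ[ℂ] (toThm418Data C (R μ hμ hg)).omegaAt (σ μ hμ hg a))
    (he : ∀ (μ : T.Char) (hμ : T.PhiMu μ) (hg : Good μ) (a : T.Adm μ) (g : ↥V.adelicFin) (m : T.Ω μ a),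
      e μ hμ hg a (MonoidAlgebra.of ℂ ↥V.adelicFin g • m) = (toThm418Data C (R μ hμ hg)).rhoAt (σ μ hμ hg a) g (e μ hμ hg a m))
    (M : ∀ (μ : T.Char) (hμ : T.PhiMu μ) (hg : Good μ), (toThm418Data C (R μ hμ hg)).Map43RationalData)
    (jH : ∀ (μ : T.Char) (hμ : T.PhiMu μ) (hg : Good μ), (M μ hμ hg).HB →ₗ[ℂ] T.H)
    (hjHinj : ∀ (μ : T.Char) (hμ : T.PhiMu μ) (hg : Good μ), Function.Injective (jH μ hμ hg))
    (hjH : ∀ (μ : T.Char) (hμ : T.PhiMu μ) (hg : Good μ) (g : ↥V.adelicFin) (x : (M μ hμ hg).HB),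
      jH μ hμ hg ((M μ hμ hg).ρB g x) = MonoidAlgebra.of ℂ ↥V.adelicFin g • jH μ hμ hg x)
    -- ── R3 RESOLVED BELOW THE THRESHOLD: the four pieces per (good μ, level K ≤ Ks μ) ──
    (Ks : T.Char → HodgeCM.Level V)
    (pieces : ∀ (μ : T.Char) (hμ : T.PhiMu μ) (hg : Good μ) (K : HodgeCM.Level V), K ≤ Ks μ →
      HcmPieces.{0, v, w} (toThm418Data C (R μ hμ hg)) (M μ hμ hg) T.H (jH μ hμ hg) K.K (W K) (res K) (cmCl K μ))
    (hnvD : ∀ (μ : T.Char) (hμ : T.PhiMu μ) (hg : Good μ) (i : (toThm418Data C (R μ hμ hg)).AdmIndex),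
      Nontrivial ((toThm418Data C (R μ hμ hg)).omegaAt i))
    (hmultD : ∀ (μ : T.Char) (hμ : T.PhiMu μ) (hg : Good μ) (i : (toThm418Data C (R μ hμ hg)).AdmIndex),
      Module.rank ℂ (Representation.IntertwiningMap ((toThm418Data C (R μ hμ hg)).rhoAt i)
        (Representation.ofModule' (k := ℂ) (G := ↥V.adelicFin) T.H)) ≤ 1) :
    T.Thm418Combined res cmCl := by
  have hP : ∀ (μ : T.Char) (hμ : T.PhiMu μ) (hg : Good μ) (K : HodgeCM.Level V),
      Nonempty (HcmPieces.{0, v, w} (toThm418Data C (R μ hμ hg)) (M μ hμ hg) T.H (jH μ hμ hg) K.K (W K) (res K)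
        {x | K ≤ Ks μ → x ∈ cmCl K μ}) := by
    intro μ hμ hg K
    by_cases hK : K ≤ Ks μ
    · exact HcmPieces.nonempty_mono (fun x hx _ => hx) (pieces μ hμ hg K hK)
    · exact HcmPieces.nonempty_mono (fun x _ hK' => absurd hK' hK)
        (Classical.choice (nonempty_hcmPieces_univ _ _ T.H (jH μ hμ hg) K.K (W K) (res K)))
  have h' : T.Thm418Combined res (fun K μ => {x | K ≤ Ks μ → x ∈ cmCl K μ}) :=
    thm418Combined_of_asPrinted_resolved V h Φ C T res (fun K μ => {x | K ≤ Ks μ → x ∈ cmCl K μ}) Good hbad R hLiu σ hσ e he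
      M jH hjHinj hjH (fun μ hμ hg K => Classical.choice (hP μ hμ hg K)) hnvD hmultD
  exact thm418Combined_of_subset_below (cmCl' := fun K μ => {x | K ≤ Ks μ → x ∈ cmCl K μ}) Ks
    (fun μ K hK x (hx : K ≤ Ks μ → x ∈ cmCl K μ) => hx hK) h'

end SmallLevels

end HodgeCM.Literature.Theta.LiuAlbaneseModuleDatum.D2Bridge

end
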